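import Summits.QuantumFields.BalabanUV.Beta.MultiscaleCombesThomas
import Summits.QuantumFields.BalabanUV.Beta.AccretiveCombesThomasBudget
import Literature.MathematicalPhysics.QuantumLattice.TorusTestPotential

/-!
# `Summit.QuantumFields.BalabanUV.Beta.MultiscaleCombesThomasBudget` — the SITEWISE budget algebra for the
# site-local Combes–Thomas engine, the SCALE-ADAPTED END (local coercivity `λ_e`, local row mass `M_e`, sitewise weight
# step `ℓ_e` with `M_e(κℓ_e)² ≤ λ_e/2` ⟹ `‖H⁻¹(i,j)‖ ≤ 2e^{−κd(i,j)}/√(λ_iλ_j)`), and the REAL bridge (v1.0.1; file 2 of 2; file 1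
# `MultiscaleCombesThomas` = the engine)

HONEST FRAMING (page 1 of everything in this cell).  Discharging `FlowStep.BetaPertH` would make Bałaban's
ultraviolet stability UNCONDITIONAL — a constructive-QFT result; it is NOT the continuum limit and NOT the Clay
problem.  This module discharges nothing of `BetaPertH`; it is ELEMENTARY finite-dimensional linear algebra
([folklore]: Combes–Thomas ∕ Agmon budgets, sitewise), kernel-checked, written by the OWNER of binder row D4 (unit
`b2b-balaban-beta-an4`, gen 42; claim «MULTISCALE-CT-LOCAL», journal l.17755) for NODE O.2 item (v) «k-UNIFORM
constants», DECAY half.  HONEST DEPENDENCY: continuum YM on T⁴ ⇐ BetaPertH ∧ nine spine estimates (0/9 proved);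
BetaPertH ⇐ (D1) ∧ (D4) ∧ CAP+tail; G-an2-4 gates asym, D1 and NE2/3/4.

CONTENT (all [folklore]; hypothesis SHAPES written out, no `Prop`-valued definitions: «`A` is locally coercive with
profile `λ`» = `∀ z, Σ_e λ_e‖z_e‖² ≤ Re z^*Az`; «conjugation of `A` at `(κ, ρ)` costs at most `J` sitewise» =
`∀ z, Re z^*Az − Σ_e J_e‖z_e‖² ≤ Re conjForm A κ ρ z`; «locally conjugated-coercive with profile `μ`» =
`∀ z, Σ_e μ_e‖z_e‖² ≤ Re conjForm A κ ρ z`).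
* §4 THE LOCAL BUDGET ALGEBRA: sitewise costs add (`localLower_add`), are monotone (`localLower_mono`), turn a local
  coercivity profile `λ` into the local conjugated profile `λ − J` (`localConjCoercive_of_localLower`), positive parts
  cost only their sitewise defect (`localConjCoercive_add_of_re_nonneg` — the local monotone-majorant clause); a
  HERMITIAN kernel costs its cosh row defect AT EACH SITE `ctRowDefect H κ ρ e = Σ_{e′} ‖H(e,e′)‖(cosh κ(ρ_e − ρ_{e′}) − 1)`
  (`localLower_of_isHermitian` — `DeltaACombesThomas.re_conjugated_form` BY NAME; the budget module's
  `conjLower_of_isHermitian` is this followed by `sup_e`); an ARBITRARY remainder costs `½(expRowDefect + expColDefect)`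
  AT EACH SITE (`localLower_of_expDefect`).
* §4b THE SCALE-ADAPTED END — the multiscale point made exact: the cosh pair weight is SECOND order in the weight
  step (`ctWeight_le_sq_of_abs_sub_le`: `|ρ_e − ρ_{e′}| ≤ ℓ`, `κℓ ≤ 1` ⟹ `cosh − 1 ≤ (κℓ)²`, via the landed
  `QuantumLattice.cosh_sub_one_le_sq_of_abs_le_one`), so a Hermitian kernel whose row `e` has mass `Σ_{e′}‖H(e,e′)‖ ≤ M_e`
  and sees weight steps `≤ ℓ_e` costs `M_e(κℓ_e)²` AT SITE `e` (`ctRowDefect_le_of_local_scale`); hence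
  **`norm_inv_apply_le_of_scaleAdapted`**: local coercivity `λ_e`, `M_e(κℓ_e(j))² ≤ λ_e/2` for the weights `d(·,j)`
  ⟹ `‖H⁻¹(i,j)‖ ≤ 2e^{−κ d(i,j)}/√(λ_iλ_j)`.  For a Laplacian with coefficients `η⁻²` (`M_e ≍ z·η⁻²`), local coercivity
  `λ_e = κ₀(L^{j(e)}η)⁻²` on region `Λ_{j(e)}` and the weight `δ₀·d(·,y)` with step `ℓ_e = δ₀L^{−j}` across a bond of `Λ_j`,
  the cost is `zκ²δ₀²(L^jη)⁻²` — the SAME scale as `λ_e`: `zκ²δ₀² ≤ κ₀/2` is free of `j`, of the number of levels and of the volume;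
  the bound `(2/κ₀)(L^{j(i)}η)(L^{j(j)}η)e^{−κδ₀d(i,j)}` is (3.42)'s local-prefactor shape at the ENTRY ∕ ℓ²-pairing level ONLY (print's
  (3.42) is a sup-norm bound, ONE prefactor `(L^jη)²` at the target, source in sup norm over `Δ(y′)`; the entry → sup transfer is NOT
  level-free; level-free = the ℓ²-pairing `combesThomas_local`; the local `ℓ² → ℓ^∞` step is item (ii); XREAD C-d4p3-28 INFO-1; B6 (2.46)).
* §5 THE REAL BRIDGE (for real model operators, e.g. the co-owner's `CovariantTowerMatrix.cmat` images): the real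
  conjugated quadratic form `realConjForm M κ ρ w = Σ_{e,e′} w_e e^{κ(ρ_e−ρ_{e′})} M(e,e′) w_{e′}`,
  `re_conjForm_map_ofReal` (`Re conjForm (M.map ofReal) κ ρ z = realConjForm M κ ρ (Re z) + realConjForm M κ ρ (Im z)`),
  `localConjCoercive_of_real`, `map_ofReal_inv`, the real END **`abs_inv_apply_le_local_real`**
  (`|M⁻¹(i,j)| ≤ e^{−κ d(i,j)}/√(μ_i μ_j)` from the REAL local hypothesis alone), and the JUNCTION with the MODEL's
  conjugation currency: `realConjForm_toMatrix'` (the real conjugated form of `toMatrix′ A` is the conjugated pairing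
  `Σ_p e^{κρ_p}v_p(A(e^{−κρ}v))_p = ⟨v,Av⟩ + ERR`, pv21 `B9Thm37GlueTorusCovCT.conjErr`'s bookkeeping) and
  **`norm_cmat_inv_apply_le_local`** (the END for `((toMatrix′ A).map ofReal)⁻¹` = beta-d4-p2's `cmat A` by `rfl`, from
  `⟨v,Av⟩ + ERR_{κd(·,j)}(A;v) ≥ Σ_p μ_p v_p²` on real vectors).

ABSOLUTE RULE.  Nothing printed is cited as a fact; no manuscript statement enters as a hypothesis; (3.24) ∕ (3.42) ∕
Thm 3.1 of [Balaban1985BackgroundPropagators] are LOCATORS of the shape only.  Nothing of Bałaban's operators is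
instantiated; no weight, metric or cell geometry is constructed here (instance data).  Declarations of file 1, of the
lineage's `AccretiveCombesThomas(Budget)`, of r1's `Beta.DeltaACombesThomas`, of `QuantumLattice` and of b05's
`B5Prop11Lower` are used BY NAME, never restated.  Row D4: abstract engine for O.2 item (v)'s decay half; class of
(T3) ∕ NODE O.2 UNCHANGED (critical-path width 0); D4 DISCHARGE NO DATE; NOT BetaPertH, NOT continuum, NOT Clay, NOT
summit progress.  References (method only): Combes–Thomas, CMP 34 (1973) 251–270; Agmon, Princeton 1982.
-/

open scoped BigOperators Matrix ComplexConjugate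
open Finset Complex Matrix

namespace Summit.QuantumFields.BalabanUV.Beta.MultiscaleCombesThomasBudget

open Summit.QuantumFields.BalabanUV.Beta.AccretiveCombesThomas
open Summit.QuantumFields.BalabanUV.Beta.AccretiveCombesThomasBudget (expWeight expWeight_nonneg expRowDefect
  expColDefect expRowDefect_nonneg expColDefect_nonneg norm_conjForm_sub_form_le)
open Summit.QuantumFields.BalabanUV.Beta.MultiscaleCombesThomas
open Literature.MathematicalPhysics.QuantumFieldTheory.Balaban1983to89.B5Prop11Lower (nsq nsq_nonneg
  norm_star_dotProduct_le)
open Literature.MathematicalPhysics.QuantumFieldTheory.Balaban1983to89.Beta.DeltaACombesThomas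
  (ctWeight ctWeight_nonneg ctWeight_symm ctRowDefect ctRowDefect_nonneg re_conjugated_form)

noncomputable section

variable {ι : Type*} [Fintype ι]

/-! ## §4 The local budget algebra -/

/-- **Local coercivity minus sitewise cost = local conjugated coercivity.** [folklore] -/
theorem localConjCoercive_of_localLower {A : Matrix ι ι ℂ} {κ : ℝ} {ρ : ι → ℝ} {lam J : ι → ℝ}
    (hA : ∀ z : ι → ℂ, ∑ e, lam e * ‖z e‖ ^ 2 ≤ (star z ⬝ᵥ (A *ᵥ z)).re)
    (hJ : ∀ z : ι → ℂ, (star z ⬝ᵥ (A *ᵥ z)).re - ∑ e, J e * ‖z e‖ ^ 2 ≤ (conjForm A κ ρ z).re) (z : ι → ℂ) :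
    ∑ e, (lam e - J e) * ‖z e‖ ^ 2 ≤ (conjForm A κ ρ z).re := by
  have hsplit : ∑ e, (lam e - J e) * ‖z e‖ ^ 2 = ∑ e, lam e * ‖z e‖ ^ 2 - ∑ e, J e * ‖z e‖ ^ 2 := by
    rw [← Finset.sum_sub_distrib]
    exact Finset.sum_congr rfl fun e _ => by ring
  linarith [hA z, hJ z]

/-- **Sitewise costs add.** [folklore] -/
theorem localLower_add {A B : Matrix ι ι ℂ} {κ : ℝ} {ρ : ι → ℝ} {J₁ J₂ : ι → ℝ}
    (h₁ : ∀ z : ι → ℂ, (star z ⬝ᵥ (A *ᵥ z)).re - ∑ e, J₁ e * ‖z e‖ ^ 2 ≤ (conjForm A κ ρ z).re)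
    (h₂ : ∀ z : ι → ℂ, (star z ⬝ᵥ (B *ᵥ z)).re - ∑ e, J₂ e * ‖z e‖ ^ 2 ≤ (conjForm B κ ρ z).re) (z : ι → ℂ) :
    (star z ⬝ᵥ ((A + B) *ᵥ z)).re - ∑ e, (J₁ e + J₂ e) * ‖z e‖ ^ 2 ≤ (conjForm (A + B) κ ρ z).re := by
  have ha := h₁ z
  have hb := h₂ z
  have hsplit : ∑ e, (J₁ e + J₂ e) * ‖z e‖ ^ 2 = ∑ e, J₁ e * ‖z e‖ ^ 2 + ∑ e, J₂ e * ‖z e‖ ^ 2 := by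
    rw [← Finset.sum_add_distrib]
    exact Finset.sum_congr rfl fun e _ => by ring
  rw [conjForm_add, Complex.add_re, Matrix.add_mulVec, dotProduct_add, Complex.add_re, hsplit]
  linarith

/-- **Sitewise costs are monotone.** [folklore] -/
theorem localLower_mono {A : Matrix ι ι ℂ} {κ : ℝ} {ρ : ι → ℝ} {J J' : ι → ℝ}
    (h : ∀ z : ι → ℂ, (star z ⬝ᵥ (A *ᵥ z)).re - ∑ e, J e * ‖z e‖ ^ 2 ≤ (conjForm A κ ρ z).re)
    (hJ : ∀ e, J e ≤ J' e) (z : ι → ℂ) :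
    (star z ⬝ᵥ (A *ᵥ z)).re - ∑ e, J' e * ‖z e‖ ^ 2 ≤ (conjForm A κ ρ z).re := by
  linarith [h z, Finset.sum_le_sum fun e (_ : e ∈ univ) => mul_le_mul_of_nonneg_right (hJ e) (sq_nonneg ‖z e‖)]

/-- **The monotone-majorant clause, local form**: a part `P` with `Re z^*Pz ≥ 0` is dropped from the coercivity side
and enters ONLY through its sitewise defect. [folklore] -/
theorem localConjCoercive_add_of_re_nonneg {A P : Matrix ι ι ℂ} {κ : ℝ} {ρ : ι → ℝ} {lam J J' : ι → ℝ}
    (hA : ∀ z : ι → ℂ, ∑ e, lam e * ‖z e‖ ^ 2 ≤ (star z ⬝ᵥ (A *ᵥ z)).re)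
    (hP : ∀ z : ι → ℂ, 0 ≤ (star z ⬝ᵥ (P *ᵥ z)).re)
    (hJ : ∀ z : ι → ℂ, (star z ⬝ᵥ (A *ᵥ z)).re - ∑ e, J e * ‖z e‖ ^ 2 ≤ (conjForm A κ ρ z).re)
    (hJ' : ∀ z : ι → ℂ, (star z ⬝ᵥ (P *ᵥ z)).re - ∑ e, J' e * ‖z e‖ ^ 2 ≤ (conjForm P κ ρ z).re) (z : ι → ℂ) :
    ∑ e, (lam e - (J e + J' e)) * ‖z e‖ ^ 2 ≤ (conjForm (A + P) κ ρ z).re := by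
  refine localConjCoercive_of_localLower (fun w => ?_) (localLower_add hJ hJ') z
  rw [Matrix.add_mulVec, dotProduct_add, Complex.add_re]
  linarith [hA w, hP w]

/-- **A Hermitian kernel costs its cosh row defect AT EACH SITE** (no `sup` over the sites):
`Re z^*Hz − Σ_e ctRowDefect(H, κ, ρ; e)·‖z_e‖² ≤ Re conjForm H κ ρ z`.  Proof = the cosh symmetrisation
`DeltaACombesThomas.re_conjugated_form` BY NAME and AM–GM with the symmetric pair weight; the budget module's
`conjLower_of_isHermitian` is this followed by `ctRowDefect ≤ J`. [folklore] -/
theorem localLower_of_isHermitian (H : Matrix ι ι ℂ) (hH : H.IsHermitian) (κ : ℝ) (ρ : ι → ℝ) (z : ι → ℂ) :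
    (star z ⬝ᵥ (H *ᵥ z)).re - ∑ e, ctRowDefect H κ ρ e * ‖z e‖ ^ 2 ≤ (conjForm H κ ρ z).re := by
  have hre : (conjForm H κ ρ z).re
      = ∑ e, ∑ e', ((starRingEnd ℂ) (z e) * H e e' * z e').re * Real.cosh (κ * (ρ e - ρ e')) :=
    re_conjugated_form H hH κ ρ z
  have hsplit : ∑ e, ∑ e', ((starRingEnd ℂ) (z e) * H e e' * z e').re * Real.cosh (κ * (ρ e - ρ e'))
      = (∑ e, ∑ e', ((starRingEnd ℂ) (z e) * H e e' * z e').re)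
        + ∑ e, ∑ e', ((starRingEnd ℂ) (z e) * H e e' * z e').re * ctWeight κ ρ e e' := by
    rw [← Finset.sum_add_distrib]
    refine Finset.sum_congr rfl fun e _ => ?_
    rw [← Finset.sum_add_distrib]
    refine Finset.sum_congr rfl fun e' _ => ?_
    rw [ctWeight]; ring
  have hform : (∑ e, ∑ e', ((starRingEnd ℂ) (z e) * H e e' * z e').re) = (star z ⬝ᵥ (H *ᵥ z)).re := by
    rw [star_dotProduct_mulVec_eq, Complex.re_sum]
    exact Finset.sum_congr rfl fun e _ => (Complex.re_sum _ _).symm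
  have h1 : ∀ e e', -(‖z e‖ * ‖H e e'‖ * ‖z e'‖ * ctWeight κ ρ e e')
      ≤ ((starRingEnd ℂ) (z e) * H e e' * z e').re * ctWeight κ ρ e e' := by
    intro e e'
    have hw := ctWeight_nonneg κ ρ e e'
    have hre' : -(‖z e‖ * ‖H e e'‖ * ‖z e'‖) ≤ ((starRingEnd ℂ) (z e) * H e e' * z e').re := by
      have := Complex.abs_re_le_norm ((starRingEnd ℂ) (z e) * H e e' * z e')
      rw [norm_mul, norm_mul, Complex.norm_conj] at this
      linarith [neg_abs_le ((starRingEnd ℂ) (z e) * H e e' * z e').re]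
    nlinarith
  have h2 : ∑ e, ∑ e', ‖z e‖ * ‖H e e'‖ * ‖z e'‖ * ctWeight κ ρ e e'
      ≤ ∑ e, ctRowDefect H κ ρ e * ‖z e‖ ^ 2 := by
    have hamgm : ∑ e, ∑ e', ‖z e‖ * ‖H e e'‖ * ‖z e'‖ * ctWeight κ ρ e e'
        ≤ ∑ e, ∑ e', (‖z e‖ ^ 2 + ‖z e'‖ ^ 2) / 2 * (‖H e e'‖ * ctWeight κ ρ e e') := by
      refine Finset.sum_le_sum fun e _ => Finset.sum_le_sum fun e' _ => ?_
      have hc : 0 ≤ ‖H e e'‖ * ctWeight κ ρ e e' := mul_nonneg (norm_nonneg _) (ctWeight_nonneg κ ρ e e')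
      have : ‖z e‖ * ‖z e'‖ ≤ (‖z e‖ ^ 2 + ‖z e'‖ ^ 2) / 2 := by nlinarith [sq_nonneg (‖z e‖ - ‖z e'‖)]
      calc ‖z e‖ * ‖H e e'‖ * ‖z e'‖ * ctWeight κ ρ e e'
          = (‖z e‖ * ‖z e'‖) * (‖H e e'‖ * ctWeight κ ρ e e') := by ring
        _ ≤ (‖z e‖ ^ 2 + ‖z e'‖ ^ 2) / 2 * (‖H e e'‖ * ctWeight κ ρ e e') :=
          mul_le_mul_of_nonneg_right this hc
    have hsym : ∑ e, ∑ e', ‖z e'‖ ^ 2 / 2 * (‖H e e'‖ * ctWeight κ ρ e e')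
        = ∑ e, ∑ e', ‖z e‖ ^ 2 / 2 * (‖H e e'‖ * ctWeight κ ρ e e') := by
      rw [Finset.sum_comm]
      refine Finset.sum_congr rfl fun e _ => Finset.sum_congr rfl fun e' _ => ?_
      rw [ctWeight_symm κ ρ e' e]
      have hHe : ‖H e' e‖ = ‖H e e'‖ := by
        rw [← hH.apply e e']; simp
      rw [hHe]
    calc ∑ e, ∑ e', ‖z e‖ * ‖H e e'‖ * ‖z e'‖ * ctWeight κ ρ e e'
        ≤ ∑ e, ∑ e', (‖z e‖ ^ 2 + ‖z e'‖ ^ 2) / 2 * (‖H e e'‖ * ctWeight κ ρ e e') := hamgm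
      _ = (∑ e, ∑ e', ‖z e‖ ^ 2 / 2 * (‖H e e'‖ * ctWeight κ ρ e e'))
          + ∑ e, ∑ e', ‖z e'‖ ^ 2 / 2 * (‖H e e'‖ * ctWeight κ ρ e e') := by
        rw [← Finset.sum_add_distrib]
        refine Finset.sum_congr rfl fun e _ => ?_
        rw [← Finset.sum_add_distrib]
        refine Finset.sum_congr rfl fun e' _ => ?_
        ring
      _ = ∑ e, ctRowDefect H κ ρ e * ‖z e‖ ^ 2 := by
        rw [hsym, ← Finset.sum_add_distrib]
        refine Finset.sum_congr rfl fun e _ => ?_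
        rw [ctRowDefect, Finset.sum_mul, ← Finset.sum_add_distrib]
        refine Finset.sum_congr rfl fun e' _ => ?_
        ring
  have h4 : -(∑ e, ∑ e', ‖z e‖ * ‖H e e'‖ * ‖z e'‖ * ctWeight κ ρ e e')
      ≤ ∑ e, ∑ e', ((starRingEnd ℂ) (z e) * H e e' * z e').re * ctWeight κ ρ e e' := by
    rw [← Finset.sum_neg_distrib]
    refine Finset.sum_le_sum fun e _ => ?_
    rw [← Finset.sum_neg_distrib]
    exact Finset.sum_le_sum fun e' _ => h1 e e'
  rw [hre, hsplit, hform]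
  linarith

/-- **An arbitrary kernel costs the mean of its exponential row and column defects AT EACH SITE** (Schur test on the
conjugation difference, no `sup`): `Re z^*Rz − Σ_e ½(expRowDefect + expColDefect)(e)·‖z_e‖² ≤ Re conjForm R κ ρ z`.
[folklore] -/
theorem localLower_of_expDefect (R : Matrix ι ι ℂ) (κ : ℝ) (ρ : ι → ℝ) (z : ι → ℂ) :
    (star z ⬝ᵥ (R *ᵥ z)).re - ∑ e, (expRowDefect R κ ρ e + expColDefect R κ ρ e) / 2 * ‖z e‖ ^ 2
      ≤ (conjForm R κ ρ z).re := by
  have hD := norm_conjForm_sub_form_le R κ ρ z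
  have hamgm : ∑ e, ∑ e', ‖z e‖ * ‖R e e'‖ * ‖z e'‖ * expWeight κ ρ e e'
      ≤ (∑ e, ‖z e‖ ^ 2 / 2 * expRowDefect R κ ρ e) + ∑ e', ‖z e'‖ ^ 2 / 2 * expColDefect R κ ρ e' := by
    have h1 : ∑ e, ∑ e', ‖z e‖ * ‖R e e'‖ * ‖z e'‖ * expWeight κ ρ e e'
        ≤ ∑ e, ∑ e', (‖z e‖ ^ 2 / 2 * (‖R e e'‖ * expWeight κ ρ e e')
            + ‖z e'‖ ^ 2 / 2 * (‖R e e'‖ * expWeight κ ρ e e')) := by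
      refine Finset.sum_le_sum fun e _ => Finset.sum_le_sum fun e' _ => ?_
      have hw : 0 ≤ ‖R e e'‖ * expWeight κ ρ e e' := mul_nonneg (norm_nonneg _) (expWeight_nonneg κ ρ e e')
      have : ‖z e‖ * ‖z e'‖ ≤ ‖z e‖ ^ 2 / 2 + ‖z e'‖ ^ 2 / 2 := by nlinarith [sq_nonneg (‖z e‖ - ‖z e'‖)]
      calc ‖z e‖ * ‖R e e'‖ * ‖z e'‖ * expWeight κ ρ e e'
          = (‖z e‖ * ‖z e'‖) * (‖R e e'‖ * expWeight κ ρ e e') := by ring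
        _ ≤ (‖z e‖ ^ 2 / 2 + ‖z e'‖ ^ 2 / 2) * (‖R e e'‖ * expWeight κ ρ e e') :=
          mul_le_mul_of_nonneg_right this hw
        _ = _ := by ring
    refine h1.trans (le_of_eq ?_)
    rw [Finset.sum_congr rfl fun e _ => Finset.sum_add_distrib, Finset.sum_add_distrib]
    congr 1
    · refine Finset.sum_congr rfl fun e _ => ?_
      rw [expRowDefect, Finset.mul_sum]
    · rw [Finset.sum_comm]
      refine Finset.sum_congr rfl fun e' _ => ?_
      rw [expColDefect, Finset.mul_sum]
  have hsum : (∑ e, ‖z e‖ ^ 2 / 2 * expRowDefect R κ ρ e) + ∑ e', ‖z e'‖ ^ 2 / 2 * expColDefect R κ ρ e'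
      = ∑ e, (expRowDefect R κ ρ e + expColDefect R κ ρ e) / 2 * ‖z e‖ ^ 2 := by
    rw [← Finset.sum_add_distrib]
    exact Finset.sum_congr rfl fun e _ => by ring
  have hre : (star z ⬝ᵥ (R *ᵥ z)).re - ‖conjForm R κ ρ z - star z ⬝ᵥ (R *ᵥ z)‖ ≤ (conjForm R κ ρ z).re := by
    have h := Complex.abs_re_le_norm (conjForm R κ ρ z - star z ⬝ᵥ (R *ᵥ z))
    rw [Complex.sub_re] at h
    linarith [le_abs_self ((conjForm R κ ρ z).re - (star z ⬝ᵥ (R *ᵥ z)).re),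
      neg_abs_le ((conjForm R κ ρ z).re - (star z ⬝ᵥ (R *ᵥ z)).re)]
  linarith

/-! ## §4b The scale-adapted END: second-order sitewise defects against a local coercivity profile -/

omit [Fintype ι] in
/-- **The cosh pair weight is SECOND order in the weight step**: `|ρ_e − ρ_{e′}| ≤ ℓ`, `0 ≤ κ`, `κℓ ≤ 1` ⟹
`cosh(κ(ρ_e − ρ_{e′})) − 1 ≤ (κℓ)²` (the landed `QuantumLattice.cosh_sub_one_le_sq_of_abs_le_one` BY NAME). [folklore] -/
theorem ctWeight_le_sq_of_abs_sub_le {κ ℓ : ℝ} (hκ : 0 ≤ κ) {ρ : ι → ℝ} {e e' : ι} (h : |ρ e - ρ e'| ≤ ℓ)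
    (h1 : κ * ℓ ≤ 1) : ctWeight κ ρ e e' ≤ (κ * ℓ) ^ 2 := by
  have ht : |κ * (ρ e - ρ e')| ≤ κ * ℓ := by
    rw [abs_mul, abs_of_nonneg hκ]; exact mul_le_mul_of_nonneg_left h hκ
  have hcosh := Literature.MathematicalPhysics.QuantumLattice.cosh_sub_one_le_sq_of_abs_le_one (ht.trans h1)
  rw [ctWeight]
  refine hcosh.trans ?_
  calc (κ * (ρ e - ρ e')) ^ 2 = |κ * (ρ e - ρ e')| ^ 2 := (sq_abs _).symm
    _ ≤ (κ * ℓ) ^ 2 := pow_le_pow_left₀ (abs_nonneg _) ht 2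

/-- **Sitewise second-order defect of a kernel with a local scale**: if row `e` of `H` has mass `Σ_{e′}‖H(e,e′)‖ ≤ M_e`
and sees weight steps `|ρ_e − ρ_{e′}| ≤ ℓ_e` on its support, `0 ≤ κ`, `κℓ_e ≤ 1`, then
`ctRowDefect H κ ρ e ≤ M_e·(κℓ_e)²`.  (For a Laplacian with coefficients `η⁻²` on a region of block side `L^jη` and
the weight `δ₀·d(·,y)`, `ℓ_e = δ₀L^{−j}` and the cost is `≍ z κ²δ₀²·(L^jη)⁻²`.) [folklore] -/
theorem ctRowDefect_le_of_local_scale (H : Matrix ι ι ℂ) {κ : ℝ} (hκ : 0 ≤ κ) (ρ : ι → ℝ) (ℓ M : ι → ℝ)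
    (hH : ∀ e e', H e e' ≠ 0 → |ρ e - ρ e'| ≤ ℓ e) (h1 : ∀ e, κ * ℓ e ≤ 1) (hM : ∀ e, ∑ e', ‖H e e'‖ ≤ M e)
    (e : ι) : ctRowDefect H κ ρ e ≤ M e * (κ * ℓ e) ^ 2 := by
  calc ctRowDefect H κ ρ e = ∑ e', ‖H e e'‖ * ctWeight κ ρ e e' := rfl
    _ ≤ ∑ e', ‖H e e'‖ * (κ * ℓ e) ^ 2 := by
        refine Finset.sum_le_sum fun e' _ => ?_
        by_cases h0 : H e e' = 0
        · simp [h0]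
        · exact mul_le_mul_of_nonneg_left (ctWeight_le_sq_of_abs_sub_le hκ (hH e e' h0) (h1 e)) (norm_nonneg _)
    _ = (∑ e', ‖H e e'‖) * (κ * ℓ e) ^ 2 := by rw [Finset.sum_mul]
    _ ≤ M e * (κ * ℓ e) ^ 2 := mul_le_mul_of_nonneg_right (hM e) (sq_nonneg _)

/-- **Local conjugated coercivity of a Hermitian kernel from a scale-adapted weight**: local coercivity profile `λ`,
row masses `M`, sitewise weight steps `ℓ` with `κℓ ≤ 1` ⟹ locally conjugated-coercive with profile `λ − M(κℓ)²`.
[folklore] -/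
theorem localConjCoercive_of_scaleAdapted (H : Matrix ι ι ℂ) (hH : H.IsHermitian) {κ : ℝ} (hκ : 0 ≤ κ) (ρ : ι → ℝ)
    (lam ℓ M : ι → ℝ) (hA : ∀ z : ι → ℂ, ∑ e, lam e * ‖z e‖ ^ 2 ≤ (star z ⬝ᵥ (H *ᵥ z)).re)
    (hρ : ∀ e e', H e e' ≠ 0 → |ρ e - ρ e'| ≤ ℓ e) (h1 : ∀ e, κ * ℓ e ≤ 1) (hM : ∀ e, ∑ e', ‖H e e'‖ ≤ M e)
    (z : ι → ℂ) : ∑ e, (lam e - M e * (κ * ℓ e) ^ 2) * ‖z e‖ ^ 2 ≤ (conjForm H κ ρ z).re :=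
  localConjCoercive_of_localLower hA
    (localLower_mono (localLower_of_isHermitian H hH κ ρ)
      (fun e => ctRowDefect_le_of_local_scale H hκ ρ ℓ M hρ h1 hM e)) z

/-- **THE SCALE-ADAPTED END.**  A Hermitian kernel `H`, locally coercive with profile `λ > 0`, row masses `≤ M_e`, and a
family of weights `d(·, j)` (`d(j,j) = 0`, rate `κ ≥ 0`) whose steps on row `e`'s support are `≤ ℓ_e(j)` with
`κℓ_e(j) ≤ 1` and `M_e(κℓ_e(j))² ≤ λ_e/2` — the defect lives on the SAME local scale as the coercivity — satisfies
`‖H⁻¹(i,j)‖ ≤ 2·e^{−κ d(i,j)}/√(λ_i λ_j)`: exponential decay with LOCAL prefactors `1/√λ`, constants seeing neither the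
number of scales nor the volume (an ENTRY-level statement). [cite: Balaban1985BackgroundPropagators, Thm 3.1 (3.42) p.397] -/
theorem norm_inv_apply_le_of_scaleAdapted [DecidableEq ι] (H : Matrix ι ι ℂ) (hH : H.IsHermitian)
    (d : ι → ι → ℝ) (hd0 : ∀ j, d j j = 0) {κ : ℝ} (hκ : 0 ≤ κ) (lam M : ι → ℝ) (ℓ : ι → ι → ℝ)
    (hlam : ∀ e, 0 < lam e) (hA : ∀ z : ι → ℂ, ∑ e, lam e * ‖z e‖ ^ 2 ≤ (star z ⬝ᵥ (H *ᵥ z)).re)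
    (hM : ∀ e, ∑ e', ‖H e e'‖ ≤ M e) (hρ : ∀ j e e', H e e' ≠ 0 → |d e j - d e' j| ≤ ℓ j e)
    (h1 : ∀ j e, κ * ℓ j e ≤ 1) (hsmall : ∀ j e, M e * (κ * ℓ j e) ^ 2 ≤ lam e / 2) (i j : ι) :
    ‖H⁻¹ i j‖ ≤ 2 * Real.exp (-(κ * d i j)) / Real.sqrt (lam i * lam j) := by
  have hμ : ∀ e, 0 < lam e / 2 := fun e => half_pos (hlam e)
  have hc : ∀ j, ∀ z : ι → ℂ, ∑ e, lam e / 2 * ‖z e‖ ^ 2 ≤ (conjForm H κ (fun e => d e j) z).re := by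
    intro j z
    refine le_trans (Finset.sum_le_sum fun e _ => ?_)
      (localConjCoercive_of_scaleAdapted H hH hκ (fun e => d e j) lam (ℓ j) M hA (hρ j) (h1 j) hM z)
    exact mul_le_mul_of_nonneg_right (by linarith [hsmall j e]) (sq_nonneg _)
  have h := norm_inv_apply_le_local H d hd0 hκ hμ hc i j
  have hsqrt : Real.sqrt (lam i / 2 * (lam j / 2)) = Real.sqrt (lam i * lam j) / 2 := by
    rw [show lam i / 2 * (lam j / 2) = lam i * lam j / (2 * 2) by ring, Real.sqrt_div' _ (by norm_num : (0:ℝ) ≤ 2 * 2),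
      Real.sqrt_mul_self zero_le_two]
  rw [hsqrt, div_div_eq_mul_div] at h
  calc ‖H⁻¹ i j‖ ≤ Real.exp (-(κ * d i j)) * 2 / Real.sqrt (lam i * lam j) := h
    _ = 2 * Real.exp (-(κ * d i j)) / Real.sqrt (lam i * lam j) := by ring

/-! ## §5 The real bridge -/

/-- The REAL conjugated quadratic form of a real kernel: `Σ_{e,e′} w_e e^{κ(ρ_e−ρ_{e′})} M(e,e′) w_{e′}` — the
quadratic form of `diag(e^{κρ})·M·diag(e^{−κρ})` at the real vector `w`. [folklore] -/
def realConjForm (M : Matrix ι ι ℝ) (κ : ℝ) (ρ : ι → ℝ) (w : ι → ℝ) : ℝ :=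
  ∑ e, ∑ e', w e * Real.exp (κ * (ρ e - ρ e')) * M e e' * w e'

/-- **Real kernels: the complex conjugated form splits into real and imaginary parts**:
`Re conjForm (M.map ofReal) κ ρ z = realConjForm M κ ρ (Re z) + realConjForm M κ ρ (Im z)`. [folklore] -/
theorem re_conjForm_map_ofReal (M : Matrix ι ι ℝ) (κ : ℝ) (ρ : ι → ℝ) (z : ι → ℂ) :
    (conjForm (M.map Complex.ofRealHom) κ ρ z).re
      = realConjForm M κ ρ (fun e => (z e).re) + realConjForm M κ ρ (fun e => (z e).im) := by
  rw [conjForm, Complex.re_sum, realConjForm, realConjForm, ← Finset.sum_add_distrib]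
  refine Finset.sum_congr rfl fun e _ => ?_
  rw [Complex.re_sum, ← Finset.sum_add_distrib]
  refine Finset.sum_congr rfl fun e' _ => ?_
  rw [Matrix.map_apply]
  simp only [Complex.ofRealHom_eq_coe, Complex.mul_re, Complex.mul_im, Complex.ofReal_re, Complex.ofReal_im,
    Complex.conj_re, Complex.conj_im, mul_zero, sub_zero]
  ring

/-- **Real local coercivity ⟹ the complex local hypothesis.**  If the real conjugated form of `M` at `(κ, ρ)`
dominates `Σ_e μ_e w_e²` on REAL vectors, then `M.map ofReal` is locally conjugated-coercive with the same profile.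
[folklore] -/
theorem localConjCoercive_of_real (M : Matrix ι ι ℝ) {κ : ℝ} {ρ : ι → ℝ} {μ : ι → ℝ}
    (h : ∀ w : ι → ℝ, ∑ e, μ e * w e ^ 2 ≤ realConjForm M κ ρ w) (z : ι → ℂ) :
    ∑ e, μ e * ‖z e‖ ^ 2 ≤ (conjForm (M.map Complex.ofRealHom) κ ρ z).re := by
  rw [re_conjForm_map_ofReal]
  have hsplit : ∑ e, μ e * ‖z e‖ ^ 2 = ∑ e, μ e * (z e).re ^ 2 + ∑ e, μ e * (z e).im ^ 2 := by
    rw [← Finset.sum_add_distrib]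
    exact Finset.sum_congr rfl fun e _ => by rw [Complex.sq_norm, Complex.normSq_apply]; ring
  rw [hsplit]
  exact add_le_add (h _) (h _)

/-- A real matrix whose complex image is invertible is invertible, and inversion commutes with the embedding.
[folklore] -/
theorem map_ofReal_inv [DecidableEq ι] (M : Matrix ι ι ℝ) (hM : IsUnit (M.map Complex.ofRealHom)) :
    (M.map Complex.ofRealHom)⁻¹ = M⁻¹.map Complex.ofRealHom := by
  have hdetC : IsUnit (M.map Complex.ofRealHom).det := (Matrix.isUnit_iff_isUnit_det _).mp hM
  have hdet : IsUnit M.det := by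
    rw [← RingHom.mapMatrix_apply, ← RingHom.map_det] at hdetC
    rw [isUnit_iff_ne_zero] at hdetC ⊢
    intro h0
    exact hdetC (by rw [h0, map_zero])
  refine Matrix.inv_eq_right_inv ?_
  rw [← Matrix.map_mul, Matrix.mul_nonsing_inv M hdet, Matrix.map_one Complex.ofRealHom (map_zero _) (map_one _)]

/-- **The real END**: for a REAL kernel `M` whose real conjugated forms along `d(·, j)` dominate the profile `μ > 0`
on real vectors, `|M⁻¹(i,j)| ≤ e^{−κ d(i,j)}/√(μ_i μ_j)`. [folklore] -/
theorem abs_inv_apply_le_local_real [DecidableEq ι] (M : Matrix ι ι ℝ) (d : ι → ι → ℝ) (hd0 : ∀ j, d j j = 0)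
    {κ : ℝ} {μ : ι → ℝ} (hκ : 0 ≤ κ) (hμ : ∀ e, 0 < μ e)
    (hc : ∀ j, ∀ w : ι → ℝ, ∑ e, μ e * w e ^ 2 ≤ realConjForm M κ (fun e => d e j) w) (i j : ι) :
    |M⁻¹ i j| ≤ Real.exp (-(κ * d i j)) / Real.sqrt (μ i * μ j) := by
  classical
  have hcC : ∀ j, ∀ z : ι → ℂ, ∑ e, μ e * ‖z e‖ ^ 2 ≤ (conjForm (M.map Complex.ofRealHom) κ (fun e => d e j) z).re :=
    fun j z => localConjCoercive_of_real M (hc j) z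
  have h := norm_inv_apply_le_local (M.map Complex.ofRealHom) d hd0 hκ hμ hcC i j
  -- `ι` is nonempty (it contains `j`), so the complex image is invertible by local conjugated coercivity
  have hMu : IsUnit (M.map Complex.ofRealHom) := isUnit_of_localConjCoercive hμ (hcC j)
  rw [map_ofReal_inv M hMu, Matrix.map_apply, Complex.ofRealHom_eq_coe, Complex.norm_real, Real.norm_eq_abs] at h
  exact h

/-- **The junction with the MODEL's conjugation currency.**  For a real endomorphism `A` of `Y → ℝ` (pv21 ∕ beta-d4-p2
write their operators so), the real conjugated form of its standard matrix is the CONJUGATED PAIRING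
`Σ_p e^{κρ_p}v_p·(A(e^{−κρ}v))_p` — i.e. `⟨v, Av⟩ + ERR_{κρ}(A; v)` in the currency of pv21's
`B9Thm37GlueTorusCovCT.conjErr` (whose `conjErr_eq_matrix` is the same bookkeeping). [folklore] -/
theorem realConjForm_toMatrix' [DecidableEq ι] (A : Module.End ℝ (ι → ℝ)) (κ : ℝ) (ρ : ι → ℝ) (v : ι → ℝ) :
    realConjForm (LinearMap.toMatrix' A) κ ρ v
      = ∑ p, Real.exp (κ * ρ p) * v p * A (fun q => Real.exp (-(κ * ρ q)) * v q) p := by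
  have happ : ∀ (u : ι → ℝ) (p : ι), A u p = ∑ q, LinearMap.toMatrix' A p q * u q := by
    intro u p
    have h : (LinearMap.toMatrix' A).mulVec u = A u := by
      rw [← Matrix.toLin'_apply, Matrix.toLin'_toMatrix']
    rw [← h]
    rfl
  unfold realConjForm
  refine Finset.sum_congr rfl fun p _ => ?_
  rw [happ, Finset.mul_sum]
  refine Finset.sum_congr rfl fun q _ => ?_
  rw [show κ * (ρ p - ρ q) = κ * ρ p + -(κ * ρ q) by ring, Real.exp_add]
  ring

/-- **The real END in the MODEL's currency**: a real endomorphism `A` whose conjugated pairings along the weights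
`d(·, j)` dominate the profile `μ > 0` on real vectors — `Σ_p μ_p v_p² ≤ Σ_p e^{κd(p,j)}v_p·(A(e^{−κd(·,j)}v))_p`, i.e.
`⟨v, Av⟩ + ERR ≥ Σ_p μ_p v_p²` — has `‖((toMatrix′ A).map ofReal)⁻¹(i,j)‖ ≤ e^{−κ d(i,j)}/√(μ_i μ_j)`; the matrix on the
left is beta-d4-p2's `CovariantTowerMatrix.cmat A` by `rfl`, so their `cmat_inv_of_mul_eq_one` reads it as the
entries of the inverse operator. [folklore] -/
theorem norm_cmat_inv_apply_le_local [DecidableEq ι] (A : Module.End ℝ (ι → ℝ)) (d : ι → ι → ℝ)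
    (hd0 : ∀ j, d j j = 0) {κ : ℝ} {μ : ι → ℝ} (hκ : 0 ≤ κ) (hμ : ∀ e, 0 < μ e)
    (hc : ∀ j, ∀ v : ι → ℝ, ∑ p, μ p * v p ^ 2 ≤
      ∑ p, Real.exp (κ * d p j) * v p * A (fun q => Real.exp (-(κ * d q j)) * v q) p) (i j : ι) :
    ‖((LinearMap.toMatrix' A).map Complex.ofRealHom)⁻¹ i j‖ ≤ Real.exp (-(κ * d i j)) / Real.sqrt (μ i * μ j) := by
  have hcR : ∀ j, ∀ w : ι → ℝ, ∑ e, μ e * w e ^ 2 ≤ realConjForm (LinearMap.toMatrix' A) κ (fun e => d e j) w := by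
    intro j w; rw [realConjForm_toMatrix']; exact hc j w
  exact norm_inv_apply_le_local _ d hd0 hκ hμ (fun j z => localConjCoercive_of_real _ (hcR j) z) i j

end

end Summit.QuantumFields.BalabanUV.Beta.MultiscaleCombesThomasBudget
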